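import Summits.ValiantsHypothesis.ValiantsHypothesis.Theorems.LacunarySymmetroidMatrixDescartesPivotRankOneNeedleIdentity
import Summits.ValiantsHypothesis.ValiantsHypothesis.Theorems.LacunarySymmetroidMatrixDescartesPivotRankOneFourNine

/-!
# `MatrixDescartes` census — rank-one `(2,4)₁`: DESCARTES-SHARP POLYNOMIALS HAVE SIMPLE POSITIVE ROOTS;
# the hypothetical ninth root of the `1|3` split is simple, with a non-zero needle vote

HONEST FRAMING.  Object-search cell `pub-symmetroid`, seat `val-sym-mdr-p1` (generation 17); helper file `--supports` the crux item
stmt-ValiantsHypothesis-18050 (`Theses.LacunarySymmetroid.MatrixDescartes`, OPEN, on HOLD) with NO closure claim.  The ENTRY POINT of the structural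
route to «rank-one (2,4)₁ = 8» (seat memo T-PROFILE.md, evidence on the item): on the `1|3` split the value `9` is the Descartes budget itself, so a
configuration with nine distinct positive roots is DESCARTES-SHARP, hence all nine roots are SIMPLE (general lemma below, from Mathlib's rule of signs
WITH multiplicity `Polynomial.roots_countP_pos_le_signVariations`), hence `f′ ≠ 0` at each of them, i.e. (needle identity, `…PivotRankOneNeedleIdentity`)
the exponent-weighted needle vote `∑ₖ (dₖ − e)·wₖ r^{dₖ}·F(r)[vₖ^⊥]` is non-zero at every root.  Nothing here bears on `MatrixDescartes` in its window, on
`DoorA26` / `DoorA34`, registers / credences, or `VP ≠ VNP`; the rank-one register `{8, 9}` is unchanged.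

* `rootMultiplicity_eq_one_of_descartesSharp` — for any real `f ≠ 0`: if the number of DISTINCT positive roots equals `signVariations f`, every
  positive root is simple.  `eval_derivative_ne_zero_of_descartesSharp` — and `f′` does not vanish there.
* `signVariations_elevenNomial_oneThree_le_nine` — on the `1|3` split with non-negative pair coefficients and a negative trailing (letter-`0`)
  coefficient the eleven-nomial has `signVariations ≤ 9` (two-ended budget, as in `…PivotRankOneFourNine`).
* **`rankOne_oneThree_nine_simple`** — matrix form: `d₀ < e < d₁ < d₂ < d₃`, `J` symmetric, `w₀ > 0`, `w₁, w₂, w₃ ≥ 0`, the below-pivot letter core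
  (`m(J,v₀) < 0`): if `det F` has NINE distinct positive roots then each of them is simple and `f′(r) ≠ 0`;
  **`rankOne_oneThree_nine_vote_ne_zero`** — and (with `det J < 0`) the needle vote `∑ₖ (dₖ − e)·wₖ r^{dₖ}·F(r)[vₖ^⊥] ≠ 0` at each root.

[folklore] Descartes' rule of signs with multiplicity (Mathlib); the lineage files cited.  No definitions, no named facts.
-/

-- `Summit.ValiantsHypothesis.ValiantsHypothesis.…` repeats a component by the D-0017 layout
-- (single-conjunct summit), which the `dupNamespace` linter flags; the name is mandated.
set_option linter.dupNamespace false

namespace Summit.ValiantsHypothesis.ValiantsHypothesis.Theorems.LacunarySymmetroidMatrixDescartes.Pivot.NullDirection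

open Polynomial Matrix Finset Set
open scoped BigOperators
open Summit.ValiantsHypothesis.ValiantsHypothesis.Theorems.LacunarySymmetroidMatrixDescartes.Pivot.TwoDirections.BlockLaw
  (det_rankOne_four_sum)

/-! ## 1. Descartes-sharp polynomials -/

/-- **Descartes-sharp ⇒ simple positive roots.**  If a real polynomial `f ≠ 0` has as many DISTINCT positive roots as sign variations, then every
positive root is simple: Descartes' rule bounds the positive roots counted WITH multiplicity (Mathlib `roots_countP_pos_le_signVariations`), so the
multiset of positive roots has no repetition. [folklore] -/
theorem rootMultiplicity_eq_one_of_descartesSharp (f : ℝ[X]) (hf : f ≠ 0)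
    (hsharp : (f.roots.toFinset.filter (fun x => 0 < x)).card = f.signVariations) (r : ℝ) (hr : 0 < r) (hroot : f.IsRoot r) :
    f.rootMultiplicity r = 1 := by
  classical
  have h1 : (f.roots.toFinset.filter (fun x => 0 < x)) = (f.roots.filter (fun x => 0 < x)).toFinset := by
    rw [Multiset.toFinset_filter]
  have h2 : (f.roots.filter (fun x => 0 < x)).card ≤ f.signVariations := by
    rw [← Multiset.countP_eq_card_filter]; exact f.roots_countP_pos_le_signVariations
  have h3 : ((f.roots.filter (fun x => 0 < x)).toFinset).card ≤ (f.roots.filter (fun x => 0 < x)).card := Multiset.toFinset_card_le _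
  have hnodup : (f.roots.filter (fun x => 0 < x)).Nodup := by
    rw [← Multiset.toFinset_card_eq_card_iff_nodup]
    rw [h1] at hsharp
    omega
  have hmem : r ∈ f.roots.filter (fun x => 0 < x) := Multiset.mem_filter.2 ⟨(mem_roots hf).2 hroot, hr⟩
  have hcount : (f.roots.filter (fun x => 0 < x)).count r = 1 := Multiset.count_eq_one_of_mem hnodup hmem
  rw [Multiset.count_filter_of_pos hr, count_roots] at hcount
  exact hcount

/-- **Descartes-sharp ⇒ `f′ ≠ 0` at every positive root.** [folklore] -/
theorem eval_derivative_ne_zero_of_descartesSharp (f : ℝ[X]) (hf : f ≠ 0)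
    (hsharp : (f.roots.toFinset.filter (fun x => 0 < x)).card = f.signVariations) (r : ℝ) (hr : 0 < r) (hroot : f.IsRoot r) :
    (Polynomial.derivative f).eval r ≠ 0 := by
  have hm := rootMultiplicity_eq_one_of_descartesSharp f hf hsharp r hr hroot
  have hd : (Polynomial.derivative f).rootMultiplicity r = 0 := by
    rw [derivative_rootMultiplicity_of_root hroot, hm]
  intro h0
  have hroot' : (Polynomial.derivative f).IsRoot r := h0
  have hdf : Polynomial.derivative f ≠ 0 := by
    intro hz
    -- a non-zero constant has no roots
    obtain ⟨c, hc⟩ : ∃ c, f = Polynomial.C c := ⟨f.coeff 0, eq_C_of_derivative_eq_zero hz⟩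
    rw [hc, IsRoot.def, eval_C] at hroot
    rw [hc, hroot, map_zero] at hf
    exact hf rfl
  have := (rootMultiplicity_pos hdf).2 hroot'
  omega

/-! ## 2. The `1|3` split: `signVariations ≤ 9` -/

/-- On the `1|3` split with non-negative pair coefficients and a negative coefficient at the lowest degree `e + d₀` (the below-pivot letter core),
the eleven-nomial has at most nine sign variations (two-ended budget: negative coefficients only at the five pivot-type degrees, the trailing one
negative). [folklore] -/
theorem signVariations_elevenNomial_oneThree_le_nine (e d₀ d₁ d₂ d₃ : ℕ) (h0e : d₀ < e) (he1 : e < d₁) (h12 : d₁ < d₂) (h23 : d₂ < d₃)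
    (cv : Fin 11 → ℝ) (hpos : ∀ i : Fin 11, 5 ≤ (i : ℕ) → 0 ≤ cv i) (h1 : cv 1 < 0) :
    (∑ i : Fin 11, Polynomial.C (cv i) * X ^ ((![2 * e, e + d₀, e + d₁, e + d₂, e + d₃, d₀ + d₁, d₀ + d₂, d₀ + d₃, d₁ + d₂, d₁ + d₃, d₂ + d₃] : Fin 11 → ℕ) i)).signVariations ≤ 9 := by
  classical
  set f := (∑ i : Fin 11, Polynomial.C (cv i) * X ^ ((![2 * e, e + d₀, e + d₁, e + d₂, e + d₃, d₀ + d₁, d₀ + d₂, d₀ + d₃, d₁ + d₂, d₁ + d₃, d₂ + d₃] : Fin 11 → ℕ) i)) with hf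
  have htrail : f.trailingCoeff < 0 := by
    rw [hf, RankOneReduction.trailingCoeff_elevenNomial_oneThree e d₀ d₁ d₂ d₃ h0e he1 h12 h23 cv h1.ne]; exact h1
  have hneg : ∀ m, f.coeff m < 0 → m = 2 * e ∨ m = e + d₀ ∨ m = e + d₁ ∨ m = e + d₂ ∨ m = e + d₃ :=
    fun m hm => RankOneReduction.eq_pivotDegree_of_coeff_neg e d₀ d₁ d₂ d₃ cv hpos m hm
  have hb := Census.signVariations_two_ended_le f
  rw [if_pos htrail] at hb
  set S : Finset ℕ := {2 * e, e + d₀, e + d₁, e + d₂, e + d₃} with hS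
  have hsub : Pivot.TwoDescartes.negSupp f ⊆ S := by
    intro n hn
    simp only [Pivot.TwoDescartes.negSupp, Finset.mem_filter] at hn
    have := hneg n hn.2
    simp only [hS, Finset.mem_insert, Finset.mem_singleton]
    omega
  have hc := Finset.card_le_card hsub
  have h5 : S.card ≤ 5 := Finset.card_le_five
  split_ifs at hb <;> omega

/-! ## 3. Matrix form: nine roots on the `1|3` split are simple -/

/-- **NINE ROOTS ON THE `1|3` SPLIT ARE SIMPLE.**  `F = X^e J + ∑ₖ wₖ X^{dₖ} vₖvₖᵀ` with `d₀ < e < d₁ < d₂ < d₃`, `J` any real `2 × 2` matrix, `w₀ > 0`,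
`w₁, w₂, w₃ ≥ 0` and the below-pivot letter core (`m(J,v₀) < 0`): if `det F` has nine distinct positive roots (the Descartes budget of this split,
`rankOne_posRoots_le_nine`), then every positive root is SIMPLE and `(det F)′` does not vanish there. [this file] -/
theorem rankOne_oneThree_nine_simple (e d₀ d₁ d₂ d₃ : ℕ) (h0e : d₀ < e) (he1 : e < d₁) (h12 : d₁ < d₂) (h23 : d₂ < d₃)
    (J : Matrix (Fin 2) (Fin 2) ℝ) (v₀ v₁ v₂ v₃ : Fin 2 → ℝ) (w₀ w₁ w₂ w₃ : ℝ) (hw₀ : 0 < w₀) (hw₁ : 0 ≤ w₁) (hw₂ : 0 ≤ w₂)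
    (hw₃ : 0 ≤ w₃) (hm₀ : J 0 0 * v₀ 1 ^ 2 + J 1 1 * v₀ 0 ^ 2 - (J 0 1 + J 1 0) * (v₀ 0 * v₀ 1) < 0)
    (hnine : ((Matrix.det (((X : ℝ[X]) ^ e) • J.map Polynomial.C
        + (Polynomial.C w₀ * X ^ d₀) • (vecMulVec v₀ v₀).map Polynomial.C
        + (Polynomial.C w₁ * X ^ d₁) • (vecMulVec v₁ v₁).map Polynomial.C
        + (Polynomial.C w₂ * X ^ d₂) • (vecMulVec v₂ v₂).map Polynomial.C
        + (Polynomial.C w₃ * X ^ d₃) • (vecMulVec v₃ v₃).map Polynomial.C)).roots.toFinset.filter (fun t => 0 < t)).card = 9)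
    (r : ℝ) (hr : 0 < r)
    (hroot : (Matrix.det (((X : ℝ[X]) ^ e) • J.map Polynomial.C
        + (Polynomial.C w₀ * X ^ d₀) • (vecMulVec v₀ v₀).map Polynomial.C
        + (Polynomial.C w₁ * X ^ d₁) • (vecMulVec v₁ v₁).map Polynomial.C
        + (Polynomial.C w₂ * X ^ d₂) • (vecMulVec v₂ v₂).map Polynomial.C
        + (Polynomial.C w₃ * X ^ d₃) • (vecMulVec v₃ v₃).map Polynomial.C)).IsRoot r) :
    (Matrix.det (((X : ℝ[X]) ^ e) • J.map Polynomial.C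
        + (Polynomial.C w₀ * X ^ d₀) • (vecMulVec v₀ v₀).map Polynomial.C
        + (Polynomial.C w₁ * X ^ d₁) • (vecMulVec v₁ v₁).map Polynomial.C
        + (Polynomial.C w₂ * X ^ d₂) • (vecMulVec v₂ v₂).map Polynomial.C
        + (Polynomial.C w₃ * X ^ d₃) • (vecMulVec v₃ v₃).map Polynomial.C)).rootMultiplicity r = 1
    ∧ (Polynomial.derivative (Matrix.det (((X : ℝ[X]) ^ e) • J.map Polynomial.C
        + (Polynomial.C w₀ * X ^ d₀) • (vecMulVec v₀ v₀).map Polynomial.C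
        + (Polynomial.C w₁ * X ^ d₁) • (vecMulVec v₁ v₁).map Polynomial.C
        + (Polynomial.C w₂ * X ^ d₂) • (vecMulVec v₂ v₂).map Polynomial.C
        + (Polynomial.C w₃ * X ^ d₃) • (vecMulVec v₃ v₃).map Polynomial.C))).eval r ≠ 0 := by
  classical
  set f := Matrix.det (((X : ℝ[X]) ^ e) • J.map Polynomial.C
        + (Polynomial.C w₀ * X ^ d₀) • (vecMulVec v₀ v₀).map Polynomial.C
        + (Polynomial.C w₁ * X ^ d₁) • (vecMulVec v₁ v₁).map Polynomial.C
        + (Polynomial.C w₂ * X ^ d₂) • (vecMulVec v₂ v₂).map Polynomial.C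
        + (Polynomial.C w₃ * X ^ d₃) • (vecMulVec v₃ v₃).map Polynomial.C) with hfdef
  -- `signVariations f ≤ 9` from the eleven-nomial form
  have hpair : ∀ i : Fin 11, 5 ≤ (i : ℕ) →
      0 ≤ (![J.det, w₀ * (J 0 0 * v₀ 1 ^ 2 + J 1 1 * v₀ 0 ^ 2 - (J 0 1 + J 1 0) * (v₀ 0 * v₀ 1)), w₁ * (J 0 0 * v₁ 1 ^ 2 + J 1 1 * v₁ 0 ^ 2 - (J 0 1 + J 1 0) * (v₁ 0 * v₁ 1)), w₂ * (J 0 0 * v₂ 1 ^ 2 + J 1 1 * v₂ 0 ^ 2 - (J 0 1 + J 1 0) * (v₂ 0 * v₂ 1)), w₃ * (J 0 0 * v₃ 1 ^ 2 + J 1 1 * v₃ 0 ^ 2 - (J 0 1 + J 1 0) * (v₃ 0 * v₃ 1)), w₀ * w₁ * ((v₀ 0 * v₁ 1 - v₀ 1 * v₁ 0) ^ 2), w₀ * w₂ * ((v₀ 0 * v₂ 1 - v₀ 1 * v₂ 0) ^ 2), w₀ * w₃ * ((v₀ 0 * v₃ 1 - v₀ 1 * v₃ 0) ^ 2), w₁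 * w₂ * ((v₁ 0 * v₂ 1 - v₁ 1 * v₂ 0) ^ 2), w₁ * w₃ * ((v₁ 0 * v₃ 1 - v₁ 1 * v₃ 0) ^ 2), w₂ * w₃ * ((v₂ 0 * v₃ 1 - v₂ 1 * v₃ 0) ^ 2)] : Fin 11 → ℝ) i := by
    intro i hi
    fin_cases i <;>
      first
        | (simp only [Fin.reduceFinMk, Matrix.cons_val]; positivity)
        | (norm_num at hi)
  have hsv : f.signVariations ≤ 9 := by
    rw [hfdef, det_rankOne_four_sum]
    exact signVariations_elevenNomial_oneThree_le_nine e d₀ d₁ d₂ d₃ h0e he1 h12 h23 _ hpair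
      (by simpa using mul_neg_of_pos_of_neg hw₀ hm₀)
  have hZ := Census.card_posRoots_le_signVariations f
  have hsharp : (f.roots.toFinset.filter (fun x => 0 < x)).card = f.signVariations := by
    have : (f.roots.toFinset.filter (fun x => 0 < x)).card = 9 := hnine
    omega
  have hf0 : f ≠ 0 := by
    intro hz
    have : (f.roots.toFinset.filter (fun x => 0 < x)).card = 0 := by rw [hz]; simp
    omega
  exact ⟨rootMultiplicity_eq_one_of_descartesSharp f hf0 hsharp r hr hroot,
    eval_derivative_ne_zero_of_descartesSharp f hf0 hsharp r hr hroot⟩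

/-- **Nine roots ⇒ a non-zero needle vote at each of them.**  Under the hypotheses of `rankOne_oneThree_nine_simple` with `J` symmetric: at every
positive root `r`, `∑ₖ (dₖ − e)·wₖ r^{dₖ}·F(r)[vₖ^⊥] ≠ 0` (= `r·f′(r)` by the needle identity). [this file] -/
theorem rankOne_oneThree_nine_vote_ne_zero (e d₀ d₁ d₂ d₃ : ℕ) (h0e : d₀ < e) (he1 : e < d₁) (h12 : d₁ < d₂) (h23 : d₂ < d₃)
    (J : Matrix (Fin 2) (Fin 2) ℝ) (hJ : J 1 0 = J 0 1) (v₀ v₁ v₂ v₃ : Fin 2 → ℝ) (w₀ w₁ w₂ w₃ : ℝ) (hw₀ : 0 < w₀) (hw₁ : 0 ≤ w₁)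
    (hw₂ : 0 ≤ w₂) (hw₃ : 0 ≤ w₃) (hm₀ : J 0 0 * v₀ 1 ^ 2 + J 1 1 * v₀ 0 ^ 2 - (J 0 1 + J 1 0) * (v₀ 0 * v₀ 1) < 0)
    (hnine : ((Matrix.det (((X : ℝ[X]) ^ e) • J.map Polynomial.C
        + (Polynomial.C w₀ * X ^ d₀) • (vecMulVec v₀ v₀).map Polynomial.C
        + (Polynomial.C w₁ * X ^ d₁) • (vecMulVec v₁ v₁).map Polynomial.C
        + (Polynomial.C w₂ * X ^ d₂) • (vecMulVec v₂ v₂).map Polynomial.C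
        + (Polynomial.C w₃ * X ^ d₃) • (vecMulVec v₃ v₃).map Polynomial.C)).roots.toFinset.filter (fun t => 0 < t)).card = 9)
    (r : ℝ) (hr : 0 < r)
    (hroot : (Matrix.det (((X : ℝ[X]) ^ e) • J.map Polynomial.C
        + (Polynomial.C w₀ * X ^ d₀) • (vecMulVec v₀ v₀).map Polynomial.C
        + (Polynomial.C w₁ * X ^ d₁) • (vecMulVec v₁ v₁).map Polynomial.C
        + (Polynomial.C w₂ * X ^ d₂) • (vecMulVec v₂ v₂).map Polynomial.C
        + (Polynomial.C w₃ * X ^ d₃) • (vecMulVec v₃ v₃).map Polynomial.C)).IsRoot r) :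
    ((d₀ : ℝ) - e) * (w₀ * r ^ d₀)
          * (r ^ e * (J 0 0 * (v₀ 1) ^ 2 + 2 * J 0 1 * (v₀ 1 * (-v₀ 0)) + J 1 1 * (-v₀ 0) ^ 2)
            + w₀ * r ^ d₀ * (v₀ 0 * v₀ 1 + v₀ 1 * (-v₀ 0)) ^ 2 + w₁ * r ^ d₁ * (v₁ 0 * v₀ 1 + v₁ 1 * (-v₀ 0)) ^ 2
            + w₂ * r ^ d₂ * (v₂ 0 * v₀ 1 + v₂ 1 * (-v₀ 0)) ^ 2 + w₃ * r ^ d₃ * (v₃ 0 * v₀ 1 + v₃ 1 * (-v₀ 0)) ^ 2)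
        + ((d₁ : ℝ) - e) * (w₁ * r ^ d₁)
          * (r ^ e * (J 0 0 * (v₁ 1) ^ 2 + 2 * J 0 1 * (v₁ 1 * (-v₁ 0)) + J 1 1 * (-v₁ 0) ^ 2)
            + w₀ * r ^ d₀ * (v₀ 0 * v₁ 1 + v₀ 1 * (-v₁ 0)) ^ 2 + w₁ * r ^ d₁ * (v₁ 0 * v₁ 1 + v₁ 1 * (-v₁ 0)) ^ 2
            + w₂ * r ^ d₂ * (v₂ 0 * v₁ 1 + v₂ 1 * (-v₁ 0)) ^ 2 + w₃ * r ^ d₃ * (v₃ 0 * v₁ 1 + v₃ 1 * (-v₁ 0)) ^ 2)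
        + ((d₂ : ℝ) - e) * (w₂ * r ^ d₂)
          * (r ^ e * (J 0 0 * (v₂ 1) ^ 2 + 2 * J 0 1 * (v₂ 1 * (-v₂ 0)) + J 1 1 * (-v₂ 0) ^ 2)
            + w₀ * r ^ d₀ * (v₀ 0 * v₂ 1 + v₀ 1 * (-v₂ 0)) ^ 2 + w₁ * r ^ d₁ * (v₁ 0 * v₂ 1 + v₁ 1 * (-v₂ 0)) ^ 2
            + w₂ * r ^ d₂ * (v₂ 0 * v₂ 1 + v₂ 1 * (-v₂ 0)) ^ 2 + w₃ * r ^ d₃ * (v₃ 0 * v₂ 1 + v₃ 1 * (-v₂ 0)) ^ 2)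
        + ((d₃ : ℝ) - e) * (w₃ * r ^ d₃)
          * (r ^ e * (J 0 0 * (v₃ 1) ^ 2 + 2 * J 0 1 * (v₃ 1 * (-v₃ 0)) + J 1 1 * (-v₃ 0) ^ 2)
            + w₀ * r ^ d₀ * (v₀ 0 * v₃ 1 + v₀ 1 * (-v₃ 0)) ^ 2 + w₁ * r ^ d₁ * (v₁ 0 * v₃ 1 + v₁ 1 * (-v₃ 0)) ^ 2
            + w₂ * r ^ d₂ * (v₂ 0 * v₃ 1 + v₂ 1 * (-v₃ 0)) ^ 2 + w₃ * r ^ d₃ * (v₃ 0 * v₃ 1 + v₃ 1 * (-v₃ 0)) ^ 2) ≠ 0 := by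
  obtain ⟨_, hd⟩ := rankOne_oneThree_nine_simple e d₀ d₁ d₂ d₃ h0e he1 h12 h23 J v₀ v₁ v₂ v₃ w₀ w₁ w₂ w₃ hw₀ hw₁ hw₂ hw₃ hm₀ hnine r hr
    hroot
  have h := deriv_at_root e d₀ d₁ d₂ d₃ J hJ v₀ v₁ v₂ v₃ w₀ w₁ w₂ w₃ r hroot
  rw [← h]
  exact mul_ne_zero hr.ne' hd

end Summit.ValiantsHypothesis.ValiantsHypothesis.Theorems.LacunarySymmetroidMatrixDescartes.Pivot.NullDirection
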